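import Summits.Ventures.CertifiedArithmetic.LowPrec.OptTreeRZ
import Summits.Ventures.CertifiedArithmetic.LowPrec.AccumulateDirected
import Summits.Ventures.CertifiedArithmetic.LowPrec.JRBridge

/-!
# The truncation tree law in the bit-level formats (Theorem T7 for roundTowardZero in E4M3, …, fp32)

HONEST FRAMING (venture CertifiedArithmetic / cell `pub-lowprec`): certified error envelopes and
provably optimal rounding/accumulation schemes for low-precision formats under stated cost models;
every table by two implementations; no hardware or vendor claims.

`LowPrec/OptTreeRZ`, `OptTreeRZWitness` (opt seat, OPTIMA.md Theorem T7) prove the tree law for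
ROUND-TOWARD-ZERO accumulation of nonnegative data over the Jeannerod–Rump model `F(p, emin)`,
for an ABSTRACT round-down map (`IsRoundDownNonneg p emin fl`): `exact ≤ M_t(v)·computed`,
`v = 2u - 2u²`, and the witness `witRZ` under-estimates by exactly `1 - 1/N_t`.

This file is the round-toward-zero companion of `OptTreePolyFormats`: it transfers T7 to the
venture's executable `roundTowardZero α` (IEEE roundTowardZero into the finite values of `α`,
saturating), for EVERY format `α`:
* `exists_roundDown_agreeing`: there is an `IsRoundDownNonneg (m+1) (qexp α)` map that AGREES with
  `(roundTowardZero α ·).toRat` on `[0, maxRat α]` (outside the range any round-down of the model);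
* `eval_eq_eval_rz`: for nonnegative leaves with exact sum `≤ maxRat α` the tree evaluates under
  that map exactly as under the format's truncation (truncated partial sums never exceed exact
  ones, so the whole evaluation stays in `[0, maxRat]` — a DATA-ONLY range hypothesis);
* T7(b) in `α` (`exact_le_treeM_rzUnit_mul_eval_format`, `exact_sub_eval_rz_le_format`): leaves
  values of `α`, nonnegative, `Σ xᵢ ≤ maxRat α` ⟹ `s - ŝ ≤ (1 - 1/M_t(v_α))·s` for every tree,
  `v_α = 2u_α - 2u_α²`;
* T7(c)/(d) in `α` (witness attainment `1 - 1/N_t` by format data, sequential law) are the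
  companion file `OptTreeRZFormatsWitness.lean` (it needs `OptTreeRZWitness`).
-/

namespace Summit.Ventures.CertifiedArithmetic.LowPrec.Opt

open Literature.ComputerArithmetic.JeannerodRump2018
open Literature.ComputerArithmetic.JeannerodRump2018.SumTree
open Literature.ComputerArithmetic.FloatingPoint
open Literature.ComputerArithmetic.FloatingPoint.MiniFloat

/-! ## The format's truncation is a round-down map of the model on `[0, maxRat]` -/

/-- On `[0, maxRat]` the format's `roundTowardZero` is a value of the model below its argument,
nonnegative, and above every float of the model below the argument. -/
theorem roundTowardZero_props (α : Format) {t : ℚ} (ht0 : 0 ≤ t) (ht : t ≤ α.maxRat) :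
    IsFloat (α.manBits + 1) α.qexp (roundTowardZero α t).toRat ∧
    (roundTowardZero α t).toRat ≤ t ∧ 0 ≤ (roundTowardZero α t).toRat ∧
    ∀ f : ℚ, IsFloat (α.manBits + 1) α.qexp f → f ≤ t → f ≤ (roundTowardZero α t).toRat := by
  have hq := α.quantum_pos
  have habs : |t| ≤ α.maxRat := by rw [abs_of_nonneg ht0]; exact ht
  have hrd : (roundTowardZero α t).toRat = (roundDown α t).toRat := by
    rw [toRat_roundTowardZero, toRat_roundDown, if_neg (not_lt.mpr ht0), if_neg (not_lt.mpr ht0)]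
  have h0 : 0 ≤ (roundTowardZero α t).toRat := by
    rw [toRat_roundTowardZero, if_neg (not_lt.mpr ht0)]; positivity
  refine ⟨isFloat_toRat _, ?_, h0, fun f hf hft => ?_⟩
  · have h := abs_toRat_roundTowardZero_le (α := α) t
    rw [abs_of_nonneg h0, abs_of_nonneg ht0] at h; exact h
  · rcases lt_or_ge f 0 with hf0 | hf0
    · linarith
    · obtain ⟨y, hy⟩ := exists_toRat_eq_of_isFloat hf (by rw [abs_of_nonneg hf0]; linarith)
      rw [hrd, ← hy]
      exact toRat_le_roundDown habs y (by rw [hy]; exact hft)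

/-- **THE RZ BRIDGE**: for every format there is a round-down map of the model `F(m+1, qexp α)`
(in the opt seat's sense `IsRoundDownNonneg`) that coincides with the format's `roundTowardZero`
on `[0, maxRat α]`. -/
theorem exists_roundDown_agreeing (α : Format) :
    ∃ fl : ℚ → ℚ, IsRoundDownNonneg (α.manBits + 1) α.qexp fl ∧
      ∀ t : ℚ, 0 ≤ t → t ≤ α.maxRat → fl t = (roundTowardZero α t).toRat := by
  obtain ⟨g, hg⟩ := exists_roundDown (α.manBits + 1) α.qexp
  refine ⟨fun t => if 0 ≤ t ∧ t ≤ α.maxRat then (roundTowardZero α t).toRat else g t,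
    ⟨fun t => ?_, fun t ht0 => ?_, fun t ht0 f hf hft => ?_⟩, fun t ht0 ht => by simp [ht0, ht]⟩
  · by_cases h : 0 ≤ t ∧ t ≤ α.maxRat
    · simp only [h, and_self, if_true]; exact (roundTowardZero_props α h.1 h.2).1
    · simp only [h, if_false]; exact hg.isFloat t
  · by_cases h : 0 ≤ t ∧ t ≤ α.maxRat
    · simp only [h, and_self, if_true]; exact (roundTowardZero_props α h.1 h.2).2.1
    · simp only [h, if_false]; exact hg.fl_le t ht0
  · by_cases h : 0 ≤ t ∧ t ≤ α.maxRat
    · simp only [h, and_self, if_true]; exact (roundTowardZero_props α h.1 h.2).2.2.2 f hf hft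
    · simp only [h, if_false]; exact hg.le_fl t ht0 f hf hft

/-! ## Transfer of tree evaluations -/

/-- Under a round-down map, a tree with nonnegative floating-point leaves evaluates to a
nonnegative float not exceeding its exact sum. -/
theorem eval_roundDown_bounds {p : ℕ} {emin : ℤ} {fl : ℚ → ℚ} (hfl : IsRoundDownNonneg p emin fl) :
    ∀ t : SumTree, (∀ x ∈ leaves t, IsFloat p emin x ∧ 0 ≤ x) →
      0 ≤ eval fl t ∧ eval fl t ≤ exact t ∧ IsFloat p emin (eval fl t)
  | .leaf x, h => by
      have hx := h x (by simp [leaves])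
      simp only [eval, exact]; exact ⟨hx.2, le_rfl, hx.1⟩
  | .node l r, h => by
      have hl : ∀ x ∈ leaves l, IsFloat p emin x ∧ 0 ≤ x := fun x hx => h x (by simp [leaves, hx])
      have hr : ∀ x ∈ leaves r, IsFloat p emin x ∧ 0 ≤ x := fun x hx => h x (by simp [leaves, hx])
      obtain ⟨hl0, hle, hlF⟩ := eval_roundDown_bounds hfl l hl
      obtain ⟨hr0, hre, hrF⟩ := eval_roundDown_bounds hfl r hr
      simp only [eval, exact]
      refine ⟨le_trans hl0 (hfl.le_fl _ (add_nonneg hl0 hr0) _ hlF (by linarith)),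
        le_trans (hfl.fl_le _ (add_nonneg hl0 hr0)) (add_le_add hle hre), hfl.isFloat _⟩

/-- The exact sum of a tree with nonnegative leaves is nonnegative. -/
theorem exact_nonneg_of_leaves : ∀ t : SumTree, (∀ x ∈ leaves t, 0 ≤ x) → 0 ≤ exact t
  | .leaf x, h => by simpa [exact, leaves] using h x
  | .node l r, h => by
      simp only [exact]
      exact add_nonneg (exact_nonneg_of_leaves l (fun x hx => h x (by simp [leaves, hx])))
        (exact_nonneg_of_leaves r (fun x hx => h x (by simp [leaves, hx])))

/-- **TRANSFER**: a round-down map agreeing with the format's truncation on `[0, maxRat α]`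
evaluates every tree of nonnegative floating-point leaves with exact sum `≤ maxRat α` exactly as
the format's `roundTowardZero` does (data-only range hypothesis). -/
theorem eval_eq_eval_rz {α : Format} {fl : ℚ → ℚ} (hfl : IsRoundDownNonneg (α.manBits + 1) α.qexp fl)
    (hagree : ∀ t : ℚ, 0 ≤ t → t ≤ α.maxRat → fl t = (roundTowardZero α t).toRat) :
    ∀ t : SumTree, (∀ x ∈ leaves t, IsFloat (α.manBits + 1) α.qexp x ∧ 0 ≤ x) →
      exact t ≤ α.maxRat → eval fl t = eval (fun y => (roundTowardZero α y).toRat) t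
  | .leaf x, _, _ => rfl
  | .node l r, h, hrange => by
      have hl : ∀ x ∈ leaves l, IsFloat (α.manBits + 1) α.qexp x ∧ 0 ≤ x :=
        fun x hx => h x (by simp [leaves, hx])
      have hr : ∀ x ∈ leaves r, IsFloat (α.manBits + 1) α.qexp x ∧ 0 ≤ x :=
        fun x hx => h x (by simp [leaves, hx])
      have hel := exact_nonneg_of_leaves l (fun x hx => (hl x hx).2)
      have her := exact_nonneg_of_leaves r (fun x hx => (hr x hx).2)
      simp only [exact] at hrange
      obtain ⟨hl0, hle, -⟩ := eval_roundDown_bounds hfl l hl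
      obtain ⟨hr0, hre, -⟩ := eval_roundDown_bounds hfl r hr
      simp only [eval]
      rw [← eval_eq_eval_rz hfl hagree l hl (by linarith), ← eval_eq_eval_rz hfl hagree r hr (by linarith)]
      exact hagree _ (add_nonneg hl0 hr0) (by linarith)

/-! ## T7(b) in the formats -/

/-- The leaves hypothesis in format terms: values of `α`, nonnegative. -/
theorem leaves_isFloat_of_values {α : Format} (t : SumTree)
    (ht : ∀ x ∈ leaves t, (∃ y : MiniFloat α, y.toRat = x) ∧ 0 ≤ x) :
    ∀ x ∈ leaves t, IsFloat (α.manBits + 1) α.qexp x ∧ 0 ≤ x := by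
  intro x hx
  obtain ⟨⟨y, hy⟩, hx0⟩ := ht x hx
  exact ⟨hy ▸ isFloat_toRat y, hx0⟩

/-- **THEOREM T7(b) IN FORMAT `α`**: for an evaluation tree whose leaves are nonnegative values of
`α` with exact sum `≤ maxRat α` (data only), the format's round-toward-zero evaluation satisfies
`exact ≤ M_t(v_α)·computed`, `v_α = 2u_α - 2u_α²` — every format, gradual underflow included. -/
theorem exact_le_treeM_rzUnit_mul_eval_format (α : Format) (t : SumTree)
    (ht : ∀ x ∈ leaves t, (∃ y : MiniFloat α, y.toRat = x) ∧ 0 ≤ x) (hrange : exact t ≤ α.maxRat) :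
    exact t ≤ treeM (rzUnit (α.manBits + 1)) t * eval (fun y => (roundTowardZero α y).toRat) t := by
  obtain ⟨fl, hfl, hagree⟩ := exists_roundDown_agreeing α
  have ht' := leaves_isFloat_of_values t ht
  rw [← eval_eq_eval_rz hfl hagree t ht' hrange]
  exact exact_le_treeM_mul_eval_roundDown (by omega) hfl t ht'

/-- Relative form of T7(b) in format `α`: `exact - computed ≤ (1 - 1/M_t(v_α))·exact`. -/
theorem exact_sub_eval_rz_le_format (α : Format) (t : SumTree)
    (ht : ∀ x ∈ leaves t, (∃ y : MiniFloat α, y.toRat = x) ∧ 0 ≤ x) (hrange : exact t ≤ α.maxRat) :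
    exact t - eval (fun y => (roundTowardZero α y).toRat) t
      ≤ (1 - 1 / treeM (rzUnit (α.manBits + 1)) t) * exact t := by
  obtain ⟨fl, hfl, hagree⟩ := exists_roundDown_agreeing α
  have ht' := leaves_isFloat_of_values t ht
  rw [← eval_eq_eval_rz hfl hagree t ht' hrange]
  exact exact_sub_eval_le_roundDown (by omega) hfl t ht'

end Summit.Ventures.CertifiedArithmetic.LowPrec.Opt
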